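import Literature.NumberTheory.PAdicHodge.WeilPairingPeriodExtension
import HarnessLib

/-!
# A levelwise alternating Weil tower is alternating, antisymmetric and `ℤ_p`-homogeneous on the left at the limit

Topic `Literature/NumberTheory/PAdicHodge`; THEOREMS ONLY (no definition, no named fact, no instance, no `sorry`). Discharge of the
hypotheses `healt` / `heL` of `LegendreOfPeriodHoms.exists_legendre_of_periodHoms` and of the capstone
`TatePairingPointOfKTwo.exists_const_tatePairingPoint_eq_neg_trace_of_KTwo` from the LEVELWISE alternation `e_k(S, S) = 1` of the abstract Weil
tower (true for the genuine Weil pairing, AEC III.8.1 (c)): `e_∞(S, S) = 0` (`weilContPairingPadic_toLin_self`), `e_∞(U, S) = −e_∞(S, U)`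
(`…_toLin_swap`), and `e_∞(c • S, U) = e_∞(S, U)^c` (`…_toLin_smul_left`, from the tree's right homogeneity `weilPairingPadicHom_smul_right`).

Line `kato_lever` of crux K★ `stmt-BirchSwinnertonDyer-22226`; BSD / K★ are NOT proved by this file.

## References
* J. H. Silverman, *AEC* (2009), Prop. III.8.1 (a), (c). [SilvermanAEC2009]
* K. Kato, LNM 1553 (1993), Ch. II 1.4.2. [Kato1993LNM1553]
-/

noncomputable section

open Field Function ValuativeRel WittVector

namespace Literature.NumberTheory.PAdicHodge

open Literature.NumberTheory.GaloisRepresentations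
open Literature.NumberTheory.GaloisRepresentations.IsNonarchimedeanLocalField
open Literature.NumberTheory.GaloisCohomology
open Literature.NumberTheory.EllipticCurves
open _root_.WeierstrassCurve

variable {F : Type} [Field F] [ValuativeRel F] [TopologicalSpace F] [IsNonarchimedeanLocalField F]
  {p : ℕ} [Fact p.Prime] {K₀ : Type} [Field K₀] [Algebra K₀ F] (W : WeierstrassCurve K₀)
  (e : (k : ℕ) → geomTorsion W ((p ^ k : ℕ) : ℤ) → geomTorsion W ((p ^ k : ℕ) : ℤ) → AlgebraicClosure K₀)
  (hμ : ∀ k S T, e k S T ^ (p ^ k) = 1) (hadd₁ : ∀ k S₁ S₂ T, e k (S₁ + S₂) T = e k S₁ T * e k S₂ T)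
  (hadd₂ : ∀ k S T₁ T₂, e k S (T₁ + T₂) = e k S T₁ * e k S T₂)
  (hgal : ∀ k (σ : absoluteGaloisGroup K₀) (S T : geomTorsion W ((p ^ k : ℕ) : ℤ)), σ • e k S T = e k (σ • S) (σ • T))
  (hcompat : ∀ k (S T : geomTorsion W ((p ^ (k + 1) : ℕ) : ℤ)),
    e k (torsionMulHom W (p ^ (k + 1)) (p ^ k) p (pow_succ p k).symm S)
      (torsionMulHom W (p ^ (k + 1)) (p ^ k) p (pow_succ p k).symm T) = e (k + 1) S T ^ p)

omit [ValuativeRel F] [TopologicalSpace F] [IsNonarchimedeanLocalField F] in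
/-- ★ **`e_∞(S, S) = 0`** from levelwise alternation `e_k(S_k, S_k) = 1`. [cite: SilvermanAEC2009, Prop. III.8.1 (c)] -/
theorem weilContPairingPadic_toLin_self (halt : ∀ k (S : geomTorsion W ((p ^ k : ℕ) : ℤ)), e k S S = 1) (S : W.tateModule p) :
    (weilContPairingPadic W F p e hμ hadd₁ hadd₂ hgal hcompat).toLin S S = 0 := by
  rw [weilContPairingPadic_toLin_apply]
  refine Subtype.ext (funext fun k => ?_)
  rw [coe_weilPairingPadicHom]
  refine muVal_injective F (p ^ k) (Units.ext ?_)
  rw [coe_muVal_weilPairingPadicCoord, halt, map_one]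
  change (1 : AlgebraicClosure F) = ((muVal F (p ^ k) ((0 : (muPadicSystem F p).limit).1 k) : (AlgebraicClosure F)ˣ) : AlgebraicClosure F)
  rw [show ((0 : (muPadicSystem F p).limit).1 k) = 0 from rfl, muVal_zero, Units.val_one]

omit [ValuativeRel F] [TopologicalSpace F] [IsNonarchimedeanLocalField F] in
/-- ★ **Antisymmetry `e_∞(U, S) = −e_∞(S, U)`** (from alternation and biadditivity). [cite: SilvermanAEC2009, Prop. III.8.1 (a), (c)] -/
theorem weilContPairingPadic_toLin_swap (halt : ∀ k (S : geomTorsion W ((p ^ k : ℕ) : ℤ)), e k S S = 1) (S U : W.tateModule p) :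
    (weilContPairingPadic W F p e hμ hadd₁ hadd₂ hgal hcompat).toLin U S =
      -(weilContPairingPadic W F p e hμ hadd₁ hadd₂ hgal hcompat).toLin S U := by
  have h := weilContPairingPadic_toLin_self (F := F) W e hμ hadd₁ hadd₂ hgal hcompat halt (S + U)
  simp only [map_add, LinearMap.add_apply, weilContPairingPadic_toLin_self (F := F) W e hμ hadd₁ hadd₂ hgal hcompat halt S,
    weilContPairingPadic_toLin_self (F := F) W e hμ hadd₁ hadd₂ hgal hcompat halt U, zero_add, add_zero] at h
  exact eq_neg_of_add_eq_zero_left h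

/-- `(−ζ)^a = −(ζ^a)` on `ℤ_p(1)` (twist form). [cite: Serre1968, Ch. I §1.2] -/
theorem twistHom_neg [CharZero F] (ζ : (muPadicSystem F p).limit) (a : ℤ_[p]) : twistHom F p (-ζ) a = -twistHom F p ζ a := by
  obtain ⟨x, rfl⟩ := (epsLineEquiv F p).surjective ζ
  rw [← map_neg, epsLineEquiv_apply, epsLineEquiv_apply, twistHom_twistHom, twistHom_twistHom, ← epsLineEquiv_apply,
    ← epsLineEquiv_apply, ← map_neg, neg_mul]

/-- ★ **Left `ℤ_p`-homogeneity `e_∞(a • S, U) = e_∞(S, U)^a`** (right homogeneity + antisymmetry). [cite: SilvermanAEC2009, Prop. III.8.1 (a)] -/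
theorem weilContPairingPadic_toLin_smul_left [CharZero F] (halt : ∀ k (S : geomTorsion W ((p ^ k : ℕ) : ℤ)), e k S S = 1)
    (a : ℤ_[p]) (S U : W.tateModule p) :
    (weilContPairingPadic W F p e hμ hadd₁ hadd₂ hgal hcompat).toLin (a • S) U =
      twistHom F p ((weilContPairingPadic W F p e hμ hadd₁ hadd₂ hgal hcompat).toLin S U) a := by
  rw [weilContPairingPadic_toLin_swap (F := F) W e hμ hadd₁ hadd₂ hgal hcompat halt U (a • S), weilContPairingPadic_toLin_apply,
    weilPairingPadicHom_smul_right W e hμ hadd₁ hadd₂ hcompat U S a,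
    show weilPairingPadicHom W F p e hμ hadd₁ hadd₂ hcompat U S = (weilContPairingPadic W F p e hμ hadd₁ hadd₂ hgal hcompat).toLin U S
      from rfl,
    weilContPairingPadic_toLin_swap (F := F) W e hμ hadd₁ hadd₂ hgal hcompat halt S U, twistHom_neg, neg_neg]

end Literature.NumberTheory.PAdicHodge

end
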